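import Literature.NumberTheory.ModularForms.ModularCurveComplexStructure
import Literature.Geometry.Kaehler.RiemannSurfaceHolomorphicDifferentialRealPeriods
import Literature.Geometry.Kaehler.RiemannSurfaceMeromorphicOneFormSpaces
import HarnessLib

/-!
# Holomorphic differentials on `X(Γ)` pull back to weight-two `Γ`-invariant holomorphic functions on `ℍ`,
# injectively (Shimura §2.1, Prop. 2.16; Diamond–Shurman §3.3)

Layer `Literature/NumberTheory/ModularForms`, namespace `Literature.NumberTheory.ModularForms.ModularCurve`;
sequel of `ModularCurveComplexStructure` (`X(Γ) = Cpt Γ` a compact Riemann surface, `inl ∘ π : ℍ → X(Γ)`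
holomorphic) for a finite-index `Γ ≤ SL₂(ℤ)` acting freely on `ℍ`. G. Shimura, *Introduction to the arithmetic
theory of automorphic functions* (1971), §2.1 («automorphic forms of weight 2 … differential forms on `Γ∖ℍ*`»,
Prop. 2.16); F. Diamond, J. Shurman, GTM 228, §3.3 (pull-back of holomorphic differentials of `X(Γ)` to `ℍ`).

For a holomorphic `1`-form `ω` on `X(Γ)` (the tree's `RiemannSurface.MeromorphicOneForm`, `IsHolomorphic`), the tree's
DEVELOPMENT `F : ℍ → ℂ` of `ω` along `inl ∘ π` (`MeromorphicOneForm.exists_isDevelopment`: `ℍ` is simply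
connected) is the many-valued primitive `∫ω` made single-valued on `ℍ`; `f = dF∕dz` is then:

* holomorphic (`mdifferentiable_devDeriv`), `Γ`-invariant of weight two (`devDeriv_slash`: differentiate
  `F(γz) = F(z) + c(γ)`), additive and homogeneous in `ω` (`devDeriv_add`, `devDeriv_const_mul`);
* ★ ZERO ONLY IF `ω = 0` (`eq_zero_of_devDeriv_eq_zero`): if `f = 0` then `F` is constant, so every local
  primitive of `ω` is constant on the image of a small ball under the OPEN map `inl ∘ π` and `ω` vanishes on the
  dense open `Y(Γ) ⊆ X(Γ)` (`apply_eq_zero_of_isDevelopment_const`, for any open `q`), hence identically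
  (identity theorem for forms on the connected `X(Γ)`).

The vanishing AT THE CUSPS (so that `f` is a cusp form) and the assembly `Ω¹(X(Γ)) ↪ S₂(Γ)` are the sequel
`ModularCurveCuspForms`. The development/derivative computations are the ones of the Summit-side cocompact file
`…CartanCoverPrintClausesDevelopment` (crux 24801), re-run along `inl ∘ π` instead of `π`. Everything is proved;
one definition (`devDeriv F = (F ∘ ofComplex)′`).

## References

* G. Shimura, *Introduction to the arithmetic theory of automorphic functions* (1971), §2.1, Prop. 2.16. [ShimuraIATAF1971]
* F. Diamond, J. Shurman, *A first course in modular forms*, GTM 228 (2005), §3.3. [DiamondShurman2005]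
* H. M. Farkas, I. Kra, *Riemann Surfaces*, GTM 71 (1992), III.6.4 (developments). [FarkasKra1992]
-/

noncomputable section

open scoped MatrixGroups Pointwise Topology Manifold ContDiff ModularForm
open Set Filter Function UpperHalfPlane Complex
open Literature.Geometry.Kaehler Literature.Geometry.Kaehler.RiemannSurface

namespace Literature.NumberTheory.ModularForms

namespace ModularCurve

/-! ### A development along an open map which is constant kills the form -/

section OpenMap

variable {M : Type*} [TopologicalSpace M] [ChartedSpace ℂ M] {A : Type*} [TopologicalSpace A]
variable {θ : MeromorphicOneForm M} {q : A → M} {F : A → ℂ}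

/-- **If a development of `ω` along an OPEN map `q` is constant, then `ω = 0` on the image of `q`**: a local
primitive `G` with `F = G ∘ q` near `a` is constant on the open set `q(O)`, so its chart derivative — the
coefficient `ω (q a)` — vanishes. [cite: FarkasKra1992, III.6.4] -/
theorem apply_eq_zero_of_isDevelopment_const (hq : IsOpenMap q) (hF : θ.IsDevelopment q F)
    (hconst : ∀ a b, F a = F b) (a : A) : θ (q a) = 0 := by
  obtain ⟨U, -, haU, G, hG, hFG⟩ := hF a
  set e := chartAt ℂ (q a) with he
  have hder : HasDerivAt (G ∘ e.symm) (θ (q a)) (e (q a)) := hG.hasDerivAt_chartAt haU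
  -- `G ∘ e.symm` is constant near `e (q a)`
  obtain ⟨O, hOV, hO, haO⟩ := mem_nhds_iff.1 hFG
  have hqO : IsOpen (q '' O) := hq O hO
  have hGconst : ∀ m ∈ q '' O, G m = F a := by
    rintro _ ⟨b, hb, rfl⟩
    have h := hOV hb
    simp only [mem_setOf_eq, comp_apply] at h
    rw [← h, hconst b a]
  have hev : (G ∘ e.symm) =ᶠ[𝓝 (e (q a))] fun _ => F a := by
    have h1 : ContinuousAt e.symm (e (q a)) := e.continuousAt_symm (e.map_source (mem_chart_source ℂ (q a)))
    have h2 : e.symm (e (q a)) ∈ q '' O := by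
      rw [e.left_inv (mem_chart_source ℂ (q a))]; exact ⟨a, haO, rfl⟩
    filter_upwards [h1.preimage_mem_nhds (hqO.mem_nhds h2)] with w hw
    exact hGconst _ hw
  have hder0 : HasDerivAt (G ∘ e.symm) 0 (e (q a)) := (hasDerivAt_const _ _).congr_of_eventuallyEq hev
  exact hder.unique hder0

/-- **A form vanishing on an open set vanishes identically near its points** (order `⊤`). [cite: Miranda1995, Chapter IV Definition 1.9] -/
theorem meromorphicOrderAt_eq_top_of_forall_apply_eq_zero {V : Set M} (hV : IsOpen V) (h0 : ∀ m ∈ V, θ m = 0)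
    {p : M} (hp : p ∈ V) : θ.meromorphicOrderAt p = ⊤ := by
  rw [MeromorphicOneForm.meromorphicOrderAt_def, meromorphicOrderAt_eq_top_iff]
  set e := chartAt ℂ p
  have h1 : ContinuousAt e.symm (e p) := e.continuousAt_symm (e.map_source (mem_chart_source ℂ p))
  have h2 : e.symm (e p) ∈ V := by rw [e.left_inv (mem_chart_source ℂ p)]; exact hp
  have hev : ∀ᶠ w in 𝓝 (e p), e.symm w ∈ V := h1.preimage_mem_nhds (hV.mem_nhds h2)
  refine (hev.filter_mono nhdsWithin_le_nhds).mono fun w hw => ?_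
  rw [MeromorphicOneForm.localExpr, RiemannSurface.localExpr_apply, h0 _ hw, zero_mul]

end OpenMap

/-! ### Developments along `inl ∘ π : ℍ → X(Γ)` -/

section Development

variable (Γ : Subgroup SL(2, ℤ)) [Γ.FiniteIndex] [IsCancelSMul (Γ : Subgroup (GL (Fin 2) ℝ)) ℍ]

/-- The uniformising map `inl ∘ π : ℍ → X(Γ)`. [cite: ShimuraIATAF1971, §1.5] -/
abbrev toCpt : ℍ → Cpt Γ := inl Γ ∘ proj Γ

omit [IsCancelSMul (Γ : Subgroup (GL (Fin 2) ℝ)) ℍ] in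
/-- `inl ∘ π` is continuous. [cite: ShimuraIATAF1971, §1.5] -/
theorem continuous_toCpt : Continuous (toCpt Γ) := (continuous_inl Γ).comp (continuous_proj Γ)

omit [IsCancelSMul (Γ : Subgroup (GL (Fin 2) ℝ)) ℍ] in
/-- `inl ∘ π` is an open map. [cite: ShimuraIATAF1971, §1.5] -/
theorem isOpenMap_toCpt : IsOpenMap (toCpt Γ) := (isOpenEmbedding_inl Γ).isOpenMap.comp (isOpenMap_proj Γ)

omit [IsCancelSMul (Γ : Subgroup (GL (Fin 2) ℝ)) ℍ] in
/-- `inl ∘ π` is `Γ`-invariant. [cite: ShimuraIATAF1971, §1.5] -/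
theorem toCpt_smul (γ : (Γ : Subgroup (GL (Fin 2) ℝ))) (τ : ℍ) : toCpt Γ (γ • τ) = toCpt Γ τ := by
  show inl Γ (proj Γ ((γ : GL (Fin 2) ℝ) • τ)) = inl Γ (proj Γ τ)
  rw [proj_smul Γ γ.2]

variable {Γ}
variable {θ θ₁ θ₂ : MeromorphicOneForm (Cpt Γ)} {F F₁ F₂ : ℍ → ℂ}

/-- **Every holomorphic `1`-form on `X(Γ)` has a development on `ℍ`** along `inl ∘ π` (`ℍ` is simply connected),
normalised by `F(i) = 0`. [cite: FarkasKra1992, III.6.4] -/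
theorem exists_isDevelopment_toCpt (hθ : θ.IsHolomorphic) : ∃ F : ℍ → ℂ, θ.IsDevelopment (toCpt Γ) F ∧ F UpperHalfPlane.I = 0 :=
  MeromorphicOneForm.exists_isDevelopment hθ (continuous_toCpt Γ) UpperHalfPlane.I

/-- **A development on `ℍ` is holomorphic.** [cite: FarkasKra1992, III.6.4] -/
theorem mdifferentiable_of_isDevelopment (hF : θ.IsDevelopment (toCpt Γ) F) : MDifferentiable 𝓘(ℂ) 𝓘(ℂ) F := by
  intro a
  obtain ⟨G, hG, hFG⟩ := hF.exists_mdifferentiableAt (a := a)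
  have h1 : MDifferentiableAt 𝓘(ℂ) 𝓘(ℂ) (G ∘ toCpt Γ) a := hG.comp a (mdifferentiable_inl_comp_proj Γ a)
  exact h1.congr_of_eventuallyEq hFG

/-- In the coordinate of `ℍ ⊆ ℂ`: `F ∘ ofComplex` is complex-differentiable on the upper half-plane. [cite: FarkasKra1992, III.6.4] -/
theorem differentiableOn_of_isDevelopment (hF : θ.IsDevelopment (toCpt Γ) F) :
    DifferentiableOn ℂ (F ∘ UpperHalfPlane.ofComplex) {z : ℂ | 0 < z.im} :=
  UpperHalfPlane.mdifferentiable_iff.mp (mdifferentiable_of_isDevelopment hF)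

/-- **`dF∕dz`**: the derivative of a function on `ℍ` in the coordinate of `ℍ ⊆ ℂ`. [cite: ShimuraIATAF1971, §2.1] -/
def devDeriv (F : ℍ → ℂ) : ℍ → ℂ := fun τ => deriv (F ∘ UpperHalfPlane.ofComplex) τ

/-- `F ∘ ofComplex` has derivative `devDeriv F`. [cite: FarkasKra1992, III.6.4] -/
theorem hasDerivAt_of_isDevelopment (hF : θ.IsDevelopment (toCpt Γ) F) {z : ℂ} (hz : 0 < z.im) :
    HasDerivAt (F ∘ UpperHalfPlane.ofComplex) (devDeriv F (UpperHalfPlane.ofComplex z)) z := by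
  have hd : DifferentiableAt ℂ (F ∘ UpperHalfPlane.ofComplex) z :=
    (differentiableOn_of_isDevelopment hF z hz).differentiableAt (UpperHalfPlane.isOpen_upperHalfPlaneSet.mem_nhds hz)
  have h := hd.hasDerivAt
  rwa [devDeriv, UpperHalfPlane.ofComplex_apply_of_im_pos hz]

omit [Γ.FiniteIndex] [IsCancelSMul (Γ : Subgroup (GL (Fin 2) ℝ)) ℍ] in
/-- `devDeriv F ∘ ofComplex = deriv (F ∘ ofComplex)` on the upper half-plane. [cite: FarkasKra1992, III.6.4] -/
theorem devDeriv_comp_ofComplex {F : ℍ → ℂ} {z : ℂ} (hz : 0 < z.im) :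
    devDeriv F (UpperHalfPlane.ofComplex z) = deriv (F ∘ UpperHalfPlane.ofComplex) z := by
  rw [devDeriv, UpperHalfPlane.ofComplex_apply_of_im_pos hz]

/-- **`devDeriv F` is holomorphic.** [cite: ShimuraIATAF1971, §2.1] -/
theorem mdifferentiable_devDeriv (hF : θ.IsDevelopment (toCpt Γ) F) : MDifferentiable 𝓘(ℂ) 𝓘(ℂ) (devDeriv F) := by
  rw [UpperHalfPlane.mdifferentiable_iff]
  have h1 : DifferentiableOn ℂ (deriv (F ∘ UpperHalfPlane.ofComplex)) {z : ℂ | 0 < z.im} :=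
    ((differentiableOn_of_isDevelopment hF).analyticOnNhd UpperHalfPlane.isOpen_upperHalfPlaneSet).deriv.differentiableOn
  exact h1.congr fun z hz => devDeriv_comp_ofComplex hz

/-- **The periods of a development**: `F (γ τ) = F τ + c(γ)` for `γ ∈ Γ`. [cite: FarkasKra1992, III.6.4] -/
theorem exists_apply_smul_eq_add (hF : θ.IsDevelopment (toCpt Γ) F) (γ : (Γ : Subgroup (GL (Fin 2) ℝ))) :
    ∃ c : ℂ, ∀ τ : ℍ, F (γ • τ) = F τ + c :=
  hF.exists_comp_eq_add_const (continuous_toCpt Γ) (τ := fun τ => γ • τ) (continuous_const_smul γ) (toCpt_smul Γ γ)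

/-- **`devDeriv F` is `Γ`-invariant of weight two** (chain rule on `F(γz) = F(z) + c`, `d(γz)/dz = (cz+d)⁻²`).
[cite: ShimuraIATAF1971, §2.1 Prop. 2.16] -/
theorem devDeriv_slash (hF : θ.IsDevelopment (toCpt Γ) F) (γ : (Γ : Subgroup (GL (Fin 2) ℝ))) :
    (devDeriv F) ∣[(2 : ℤ)] (γ : GL (Fin 2) ℝ) = devDeriv F := by
  obtain ⟨c, hc⟩ := exists_apply_smul_eq_add hF γ
  funext τ
  have hdet' : 0 < (γ : GL (Fin 2) ℝ).det.val := by
    rw [Subgroup.HasDetOne.det_eq γ.2, Units.val_one]; exact one_pos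
  have hdet : 0 < (γ : GL (Fin 2) ℝ).val.det := by
    have : (γ : GL (Fin 2) ℝ).val.det = 1 := by
      rw [← Matrix.GeneralLinearGroup.val_det_apply, Subgroup.HasDetOne.det_eq γ.2, Units.val_one]
    rw [this]; exact one_pos
  rw [ModularForm.slash_apply]
  have hσ : ∀ w : ℂ, UpperHalfPlane.σ (γ : GL (Fin 2) ℝ) w = w := fun w => by
    rw [UpperHalfPlane.σ, if_pos hdet']; rfl
  have habs : |(γ : GL (Fin 2) ℝ).det.val| = 1 := by rw [Subgroup.HasDetOne.det_eq γ.2, Units.val_one, abs_one]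
  rw [hσ, habs]
  simp only [Complex.ofReal_one, one_zpow, mul_one]
  have hτ : 0 < (τ : ℂ).im := τ.im_pos
  have hγτ : 0 < (((γ : GL (Fin 2) ℝ) • τ : ℍ) : ℂ).im := ((γ : GL (Fin 2) ℝ) • τ).im_pos
  have h1 : HasDerivAt (fun z : ℂ => (((γ : GL (Fin 2) ℝ) • UpperHalfPlane.ofComplex z : ℍ) : ℂ))
      ((γ : GL (Fin 2) ℝ).val.det / UpperHalfPlane.denom (γ : GL (Fin 2) ℝ) τ ^ 2) τ :=
    (UpperHalfPlane.hasStrictDerivAt_smul hdet τ).hasDerivAt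
  have h2 : HasDerivAt (F ∘ UpperHalfPlane.ofComplex) (devDeriv F ((γ : GL (Fin 2) ℝ) • τ))
      ((fun z : ℂ => (((γ : GL (Fin 2) ℝ) • UpperHalfPlane.ofComplex z : ℍ) : ℂ)) (τ : ℂ)) := by
    have h := hasDerivAt_of_isDevelopment hF hγτ
    rw [UpperHalfPlane.ofComplex_apply] at h
    simp only [UpperHalfPlane.ofComplex_apply]
    exact h
  have h3 : HasDerivAt ((F ∘ UpperHalfPlane.ofComplex) ∘ fun z : ℂ => (((γ : GL (Fin 2) ℝ) • UpperHalfPlane.ofComplex z : ℍ) : ℂ))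
      (devDeriv F ((γ : GL (Fin 2) ℝ) • τ) * ((γ : GL (Fin 2) ℝ).val.det / UpperHalfPlane.denom (γ : GL (Fin 2) ℝ) τ ^ 2)) τ :=
    h2.comp (τ : ℂ) h1
  have h4 : HasDerivAt ((F ∘ UpperHalfPlane.ofComplex) ∘ fun z : ℂ => (((γ : GL (Fin 2) ℝ) • UpperHalfPlane.ofComplex z : ℍ) : ℂ))
      (devDeriv F τ) τ := by
    have h5 : HasDerivAt (fun z : ℂ => (F ∘ UpperHalfPlane.ofComplex) z + c) (devDeriv F τ) τ := by
      have h := (hasDerivAt_of_isDevelopment hF hτ).add_const c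
      rwa [UpperHalfPlane.ofComplex_apply] at h
    refine h5.congr_of_eventuallyEq ?_
    filter_upwards [UpperHalfPlane.isOpen_upperHalfPlaneSet.mem_nhds hτ] with z hz
    simp only [comp_apply, UpperHalfPlane.ofComplex_apply, UpperHalfPlane.ofComplex_apply_of_im_pos hz]
    exact hc ⟨z, hz⟩
  have h6 := h3.unique h4
  have hdet1 : ((γ : GL (Fin 2) ℝ).val.det : ℂ) = 1 := by
    have : (γ : GL (Fin 2) ℝ).val.det = 1 := by
      rw [← Matrix.GeneralLinearGroup.val_det_apply, Subgroup.HasDetOne.det_eq γ.2, Units.val_one]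
    rw [this, Complex.ofReal_one]
  rw [hdet1] at h6
  have hden : UpperHalfPlane.denom (γ : GL (Fin 2) ℝ) τ ≠ 0 := UpperHalfPlane.denom_ne_zero _ _
  rw [← h6, zpow_neg, zpow_two]
  field_simp

/-- **Additivity** of `devDeriv` on developments. [cite: FarkasKra1992, III.6.4] -/
theorem devDeriv_add (hF₁ : θ₁.IsDevelopment (toCpt Γ) F₁) (hF₂ : θ₂.IsDevelopment (toCpt Γ) F₂) :
    devDeriv (fun τ => F₁ τ + F₂ τ) = fun τ => devDeriv F₁ τ + devDeriv F₂ τ := by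
  funext τ
  have h := ((hasDerivAt_of_isDevelopment hF₁ τ.im_pos).add (hasDerivAt_of_isDevelopment hF₂ τ.im_pos)).deriv
  rw [UpperHalfPlane.ofComplex_apply] at h
  rw [devDeriv, ← h]
  rfl

/-- **Homogeneity** of `devDeriv` on developments. [cite: FarkasKra1992, III.6.4] -/
theorem devDeriv_const_mul (hF : θ.IsDevelopment (toCpt Γ) F) (c : ℂ) :
    devDeriv (fun τ => c * F τ) = fun τ => c * devDeriv F τ := by
  funext τ
  have h := ((hasDerivAt_of_isDevelopment hF τ.im_pos).const_mul c).deriv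
  rw [UpperHalfPlane.ofComplex_apply] at h
  rw [devDeriv, ← h]
  rfl

/-- Developments of the same form have the same derivative. [cite: FarkasKra1992, III.6.4] -/
theorem devDeriv_eq_of_isDevelopment (hF₁ : θ.IsDevelopment (toCpt Γ) F₁) (hF₂ : θ.IsDevelopment (toCpt Γ) F₂) :
    devDeriv F₁ = devDeriv F₂ := by
  obtain ⟨c, hc⟩ := hF₁.exists_eq_add_const hF₂ (continuous_toCpt Γ)
  funext τ
  have e1 : F₂ ∘ UpperHalfPlane.ofComplex = fun z => (F₁ ∘ UpperHalfPlane.ofComplex) z + c := by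
    funext z; simp [hc]
  simp only [devDeriv, e1, deriv_add_const]

/-! ### Injectivity: `dF∕dz = 0 ⇒ ω = 0` -/

/-- **If `dF∕dz = 0` then `ω = 0`**: `F` is constant on `ℍ`, so `ω` vanishes on the open dense `Y(Γ) ⊆ X(Γ)`
(`apply_eq_zero_of_isDevelopment_const`), hence identically near one of its points and therefore everywhere on the
connected `X(Γ)` (identity theorem for forms). [cite: ShimuraIATAF1971, §2.1 Prop. 2.16] [cite: DiamondShurman2005, §3.3] -/
theorem eq_zero_of_devDeriv_eq_zero (hθ : θ.IsHolomorphic) (hF : θ.IsDevelopment (toCpt Γ) F) (h0 : devDeriv F = 0) :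
    θ = 0 := by
  -- `F` is constant on the connected open upper half-plane
  have hconst : ∀ τ τ' : ℍ, F τ = F τ' := by
    intro τ τ'
    have h := UpperHalfPlane.isOpen_upperHalfPlaneSet.is_const_of_deriv_eq_zero (convex_halfSpace_im_gt 0).isPreconnected
      (differentiableOn_of_isDevelopment hF) (fun z hz => by
        have h1 := (hasDerivAt_of_isDevelopment hF hz).deriv
        rw [h1, h0]; rfl) τ.im_pos τ'.im_pos
    simpa [comp_apply, UpperHalfPlane.ofComplex_apply] using h
  -- `ω` vanishes on the range of `inl ∘ π`
  have hY : ∀ m ∈ range (toCpt Γ), θ m = 0 := by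
    rintro _ ⟨a, rfl⟩
    exact apply_eq_zero_of_isDevelopment_const (isOpenMap_toCpt Γ) hF hconst a
  have hopen : IsOpen (range (toCpt Γ)) := (isOpenMap_toCpt Γ).isOpen_range
  -- order `⊤` at one point, hence at every point
  have htop₀ : θ.meromorphicOrderAt (toCpt Γ UpperHalfPlane.I) = ⊤ :=
    meromorphicOrderAt_eq_top_of_forall_apply_eq_zero hopen hY (mem_range_self _)
  exact hθ.eq_zero fun p => θ.meromorphicOrderAt_eq_top_of_preconnectedSpace htop₀ p

end Development

end ModularCurve

end Literature.NumberTheory.ModularForms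

end
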